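import Mathlib.Algebra.Ring.Subring.Basic
import Mathlib.Topology.Compactness.Compact
import Mathlib.Order.SetNotation
import Mathlib.Data.Set.Lattice
import Mathlib.Data.Real.Basic
import Mathlib.Tactic.Ring
import Mathlib.Tactic.Linarith
import HarnessLib

/-!
# [IUTchIII] Remark 3.9.5: holomorphic hulls (abc-iut cell, layer L6, slice [IUTchIII] §3)

S. Mochizuki, *Inter-universal Teichmüller theory III*, kurims manuscript (May 2020) of PRIMS
**57** (2021), §3, Remark 3.9.5 (i)–(x), kurims pp. 126–145 (PRIMS offset ≈ +420). Corollary 3.12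
takes "the holomorphic hull [cf. Remark 3.9.5, (i)] of the union of the possible images of a
Θ-pilot object". STATEMENTS-FIRST typing; the elementary set-theoretic content is REAL and PROVED:

* (i) hull-sets `λ · 𝒪_{(−)} = Π_i λ_i 𝒪_{k_i}` (all `λ_i ≠ 0`) in a tensor packet `𝓘^ℚ((−)) ≅ ⊕_i k_i` and the
  **holomorphic hull** of a subset `U` = the smallest hull-set containing `U` (for `U` relatively
  compact; `𝓘^ℚ((−))` itself otherwise), defined as the intersection of all hull-sets containing `U`;
  the printed well-definedness ("One verifies immediately that the holomorphic hull is well-defined")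
  is the named statement `holomorphicHull_isHullSet`.
* (ii) `Preg` (direct product regions), `Hul` (hulls), the hull map `φ : Preg → Hul` and its characterisation
  by (P1), (P2), (P3) with `φ(P) = ⋂_{Hul ∋ H ⊇ P} H` — PROVED abstractly (`hullMap_eq_sInter`).
* (iii) `Φ(P)`, `Ξ(P)`, `H_Φ(P)`, `H_Ξ(P)` (log-volume hull-approximants) — REAL definitions; (iv)
  `φ(P) ∈ Φ(P)`, `φ(P) = H_Φ(P)` PROVED; (Ξ1), (Ξ2) named statements; the (Ξ3) example
  `I = ℚ_p × ℚ_p`, `μ(P) = 1 < 2 - p^{-1} = μ(H₀ ∪ H₁)` as a named numerical statement.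
* (v) the set-theoretic quotient `E ↠ E ⊼ S` and the observation that any map between nonempty
  subsets of `S` induces the identity on images — REAL (`Upper`, PROVED `Upper.image_eq_point`).
* (vi) the induced equivalence relation on `Hul` (named statement); (vii) (Ob2) hulls are stabilised by
  `𝒪^×` (indeed by `𝒪`) — PROVED (`IsHullSet.mul_mem`); (viii)–(x) are interpretive discussion
  ((sQ1)–(sQ5), (cQ3)–(cQ5), "one must, in effect, work with arithmetic line bundles") recorded in
  the docstrings of `Remark395ix_stable` / `Remark395x_lineBundles` only.
Topologies enter only through "relatively compact"; measures only through an abstract log-volume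
`μlog : Set X → ℝ`. Tag form [claim: Mochizuki2012, status: disputed] (D-0012 claim key).
-/

namespace Literature.IUT.LogThetaLattice

universe u v

/-! ### (i) hull-sets and the holomorphic hull -/

section Hull

variable {ι : Type u} {k : ι → Type v} [∀ i, Field (k i)] (O : ∀ i, Subring (k i))

/-- A **hull-set** in `𝓘^ℚ((−)) ≅ ⊕_i k_i` ([IUTchIII] Remark 3.9.5 (i), p. 127): a subset "of the form
`λ · 𝒪_{(−)}` — where, relative to the direct sum decomposition of `𝓘^ℚ((−))` as a direct sum of fields
…, `λ ∈ 𝓘^ℚ((−))` is an element such that each component of `λ` … is nonzero", i.e.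
`Π_i λ_i · 𝒪_{k_i}` with all `λ_i ≠ 0` (`O i` = the integral structure `𝒪_{k_i}` of Proposition 3.1 (ii)).
[claim: Mochizuki2012, status: disputed] -/
def IsHullSet (H : Set (∀ i, k i)) : Prop :=
  ∃ lam : ∀ i, k i, (∀ i, lam i ≠ 0) ∧
    H = Set.univ.pi fun i => (fun x => lam i * x) '' (O i : Set (k i))

open scoped Classical in
/-- The **holomorphic hull** of `U ⊆ 𝓘^ℚ((−))` ([IUTchIII] Remark 3.9.5 (i), p. 127): "If `U` is
relatively compact, then we define the holomorphic hull of `U` to be the smallest subset of the form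
`λ · 𝒪_{(−)}` … that contains `U`. If `U` is not relatively compact, then we define the holomorphic
hull of `U` to be `𝓘^ℚ((−))`." Defined as the intersection of all hull-sets containing `U` (resp.
`univ`); that this intersection is itself a hull-set — the smallest one — is
`holomorphicHull_isHullSet`. [claim: Mochizuki2012, status: disputed] -/
def holomorphicHull [∀ i, TopologicalSpace (k i)] (U : Set (∀ i, k i)) : Set (∀ i, k i) :=
  if IsCompact (closure U) then ⋂₀ {H | IsHullSet O H ∧ U ⊆ H} else Set.univ

/-- `U ⊆` its holomorphic hull (Remark 3.9.5 (i), p. 127: "… that contains `U`") — PROVED.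
[claim: Mochizuki2012, status: disputed] -/
theorem subset_holomorphicHull [∀ i, TopologicalSpace (k i)] (U : Set (∀ i, k i)) :
    U ⊆ holomorphicHull O U := by
  unfold holomorphicHull
  split_ifs
  · exact Set.subset_sInter fun H hH => hH.2
  · exact Set.subset_univ U

/-- The holomorphic hull is contained in every hull-set containing `U` (minimality half of
"smallest", Remark 3.9.5 (i), p. 127) — PROVED. [claim: Mochizuki2012, status: disputed] -/
theorem holomorphicHull_subset [∀ i, TopologicalSpace (k i)] {U H : Set (∀ i, k i)}
    (hU : IsCompact (closure U)) (hH : IsHullSet O H) (hUH : U ⊆ H) :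
    holomorphicHull O U ⊆ H := by
  unfold holomorphicHull
  rw [if_pos hU]
  exact Set.sInter_subset_of_mem ⟨hH, hUH⟩

/-- Well-definedness of the holomorphic hull ([IUTchIII] Remark 3.9.5 (i), p. 127: "One verifies
immediately that the holomorphic hull is well-defined [under the conditions stated]", the condition
being that `U` "contains a relatively compact subset whose log-volume … is finite"): for relatively
compact `U` of finite log-volume the intersection of all hull-sets containing `U` is itself a
hull-set. Named statement (it uses that the `k_i` are local fields: discreteness of valuations /
closedness of balls). [claim: Mochizuki2012, status: disputed] -/
def holomorphicHull_isHullSet [∀ i, TopologicalSpace (k i)] (FiniteLogVol : Set (∀ i, k i) → Prop)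
    (U : Set (∀ i, k i)) : Prop :=
  IsCompact (closure U) → FiniteLogVol U → IsHullSet O (holomorphicHull O U)

/-- [IUTchIII] Remark 3.9.5 (vii) (Ob2), p. 131 (and (ix) (cQ3), p. 141): a hull "is stabilized by
the natural action of `𝒪^×_k`" — indeed by multiplication by any element of `Π_i 𝒪_{k_i}` — PROVED.
[claim: Mochizuki2012, status: disputed] -/
theorem IsHullSet.mul_mem {H : Set (∀ i, k i)} (hH : IsHullSet O H) {a x : ∀ i, k i}
    (ha : ∀ i, a i ∈ O i) (hx : x ∈ H) : a * x ∈ H := by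
  obtain ⟨lam, -, rfl⟩ := hH
  simp only [Set.mem_univ_pi, Set.mem_image, SetLike.mem_coe] at hx ⊢
  intro i
  obtain ⟨y, hy, hyx⟩ := hx i
  refine ⟨a i * y, (O i).mul_mem (ha i) hy, ?_⟩
  rw [Pi.mul_apply, ← hyx]
  ring

end Hull

/-! ### (ii) the hull map `φ : Preg → Hul` and (P1)–(P3) -/

section HullMap

variable {X : Type u}

/-- The properties (P1), (P2), (P3) of [IUTchIII] Remark 3.9.5 (ii), p. 127, of a map `φ : Preg → Hul`
(`Hul ⊆ Preg`): "(P1) `φ(H) = H`, for any `H ∈ Hul`; (P2) `P ⊆ φ(P)`, for any `P ∈ Preg`; (P3) `φ(P₁) ⊆ φ(P₂)`, for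
any `P₁, P₂ ∈ Preg` such that `P₁ ⊆ P₂`", together with `φ(Preg) ⊆ Hul`.
[claim: Mochizuki2012, status: disputed] -/
structure IsHullMap (Preg Hul : Set (Set X)) (φ : Set X → Set X) : Prop where
  /-- `φ` takes values in `Hul` on `Preg` -/
  maps : ∀ P ∈ Preg, φ P ∈ Hul
  /-- (P1) -/
  P1 : ∀ H ∈ Hul, φ H = H
  /-- (P2) -/
  P2 : ∀ P ∈ Preg, P ⊆ φ P
  /-- (P3) -/
  P3 : ∀ P₁ ∈ Preg, ∀ P₂ ∈ Preg, P₁ ⊆ P₂ → φ P₁ ⊆ φ P₂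

/-- [IUTchIII] Remark 3.9.5 (ii), p. 127: "since … any intersection of elements of `Hul` which is of
finite log-volume necessarily determines an element of `Hul`, it follows formally from (P1), (P2), (P3)
that `φ(P) = ⋂_{Hul ∋ H ⊇ P} H` for any `P ∈ Preg`" — PROVED, with the intersection hypothesis in the form
"`⋂ {H ∈ Hul | H ⊇ P} ∈ Hul` for `P ∈ Preg`" and `Hul ⊆ Preg`. In particular `φ` "may be characterized uniquely" by
(P1)–(P3). [claim: Mochizuki2012, status: disputed] -/
theorem hullMap_eq_sInter {Preg Hul : Set (Set X)} {φ : Set X → Set X} (hφ : IsHullMap Preg Hul φ)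
    (hHP : Hul ⊆ Preg) (hinter : ∀ P ∈ Preg, ⋂₀ {H | H ∈ Hul ∧ P ⊆ H} ∈ Hul) {P : Set X} (hP : P ∈ Preg) :
    φ P = ⋂₀ {H | H ∈ Hul ∧ P ⊆ H} := by
  apply Set.Subset.antisymm
  · have h1 : P ⊆ ⋂₀ {H | H ∈ Hul ∧ P ⊆ H} := Set.subset_sInter fun H hH => hH.2
    have h2 := hφ.P3 P hP _ (hHP (hinter P hP)) h1
    rwa [hφ.P1 _ (hinter P hP)] at h2
  · exact Set.sInter_subset_of_mem ⟨hφ.maps P hP, hφ.P2 P hP⟩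

/-- Uniqueness of the hull map (Remark 3.9.5 (ii), p. 127: "characterized uniquely by" (P1)–(P3))
— PROVED from `hullMap_eq_sInter`. [claim: Mochizuki2012, status: disputed] -/
theorem hullMap_unique {Preg Hul : Set (Set X)} {φ ψ : Set X → Set X} (hφ : IsHullMap Preg Hul φ)
    (hψ : IsHullMap Preg Hul ψ) (hHP : Hul ⊆ Preg) (hinter : ∀ P ∈ Preg, ⋂₀ {H | H ∈ Hul ∧ P ⊆ H} ∈ Hul)
    {P : Set X} (hP : P ∈ Preg) : φ P = ψ P := by
  rw [hullMap_eq_sInter hφ hHP hinter hP, hullMap_eq_sInter hψ hHP hinter hP]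

end HullMap

/-! ### (iii), (iv) log-volume hull-approximants -/

section Approximants

variable {X : Type u} (Hul : Set (Set X)) (φ : Set X → Set X) (μlog : Set X → ℝ)

/-- `Φ(P) := {H ∈ Hul | φ(P) ⊇ H, μ^log(H) ≥ μ^log(P)}` ([IUTchIII] Remark 3.9.5 (iii), p. 128).
[claim: Mochizuki2012, status: disputed] -/
def PhiApprox (P : Set X) : Set (Set X) := {H | H ∈ Hul ∧ H ⊆ φ P ∧ μlog P ≤ μlog H}

/-- `Ξ(P) := {H ∈ Hul | φ(P) ⊇ H, μ^log(H) = μ^log(P)} ⊆ Φ(P)` ([IUTchIII] Remark 3.9.5 (iii), p. 128).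
[claim: Mochizuki2012, status: disputed] -/
def XiApprox (P : Set X) : Set (Set X) := {H | H ∈ Hul ∧ H ⊆ φ P ∧ μlog H = μlog P}

/-- `H_Φ(P) := ⋃_{H ∈ Φ(P)} H ⊆ φ(P)` ([IUTchIII] Remark 3.9.5 (iii), p. 128).
[claim: Mochizuki2012, status: disputed] -/
def HPhi (P : Set X) : Set X := ⋃₀ PhiApprox Hul φ μlog P

/-- `H_Ξ(P) := ⋃_{H ∈ Ξ(P)} H ⊆ H_Φ(P)` ([IUTchIII] Remark 3.9.5 (iii), p. 128).
[claim: Mochizuki2012, status: disputed] -/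
def HXi (P : Set X) : Set X := ⋃₀ XiApprox Hul φ μlog P

/-- `Ξ(P) ⊆ Φ(P)` (Remark 3.9.5 (iii), p. 128) — PROVED. [claim: Mochizuki2012, status: disputed] -/
theorem xiApprox_subset_phiApprox (P : Set X) : XiApprox Hul φ μlog P ⊆ PhiApprox Hul φ μlog P :=
  fun _ ⟨hH, hsub, heq⟩ => ⟨hH, hsub, heq.ge⟩

/-- `H_Ξ(P) ⊆ H_Φ(P) ⊆ φ(P)` (Remark 3.9.5 (iii), p. 128) — PROVED; "this indeterminacy is compact, i.e.,
… all possible choices of an element `∈ Φ(P)` or `∈ Ξ(P)` are contained in the compact set `φ(P)`".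
[claim: Mochizuki2012, status: disputed] -/
theorem hXi_subset_hPhi_subset (P : Set X) :
    HXi Hul φ μlog P ⊆ HPhi Hul φ μlog P ∧ HPhi Hul φ μlog P ⊆ φ P :=
  ⟨Set.sUnion_subset_sUnion (xiApprox_subset_phiApprox Hul φ μlog P),
    Set.sUnion_subset fun _ hH => hH.2.1⟩

/-- [IUTchIII] Remark 3.9.5 (iv), p. 128: "`φ(P) ∈ Φ(P)`, so `φ(P) = H_Φ(P)`" — PROVED for a hull map and
a monotone log-volume. [claim: Mochizuki2012, status: disputed] -/
theorem hullMap_mem_phiApprox {Preg : Set (Set X)} (hφ : IsHullMap Preg Hul φ)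
    (hmono : ∀ S T : Set X, S ⊆ T → μlog S ≤ μlog T) {P : Set X} (hP : P ∈ Preg) :
    φ P ∈ PhiApprox Hul φ μlog P ∧ φ P = HPhi Hul φ μlog P := by
  have hmem : φ P ∈ PhiApprox Hul φ μlog P :=
    ⟨hφ.maps P hP, subset_rfl, hmono _ _ (hφ.P2 P hP)⟩
  exact ⟨hmem, Set.Subset.antisymm (Set.subset_sUnion_of_mem hmem)
    (hXi_subset_hPhi_subset Hul φ μlog P).2⟩

/-- [IUTchIII] Remark 3.9.5 (iv) (Ξ1), p. 128: "If either of the following conditions is satisfied,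
then … `Ξ(P) ≠ ∅`: (Ξ1^non) … the residue field extension degree of each valuation `∈ 𝕍(K^cl)` that
divides `v_ℚ ∈ 𝕍_ℚ^non` is `= 1`, and, moreover, `μ^log(P) = μ^log(Q)`, for some `Q ∈ Preg` which is a
`ℤ_{p_{v_ℚ}}`-submodule of `𝓘^ℚ((−))`; (Ξ1^arc) `v_ℚ ∈ 𝕍_ℚ^arc`." Typed with the two conditions as abstract
predicates on the ambient situation. [claim: Mochizuki2012, status: disputed] -/
def Xi1_nonempty (ResidueDegreesOne IsArchimedean : Prop) (IsSubmoduleRegion : Set X → Prop)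
    (Preg : Set (Set X)) : Prop :=
  ∀ P ∈ Preg, ((ResidueDegreesOne ∧ ∃ Q ∈ Preg, IsSubmoduleRegion Q ∧ μlog P = μlog Q) ∨ IsArchimedean)
    → (XiApprox Hul φ μlog P).Nonempty

/-- [IUTchIII] Remark 3.9.5 (iv) (Ξ2), p. 128: in global situations (all `v_ℚ ∈ 𝕍_ℚ` at once, which
"necessarily involve the unique valuation `∈ 𝕍_ℚ^arc`") "the global analogue of '`Ξ(P)`' is nonempty"
— typed for an abstract global approximant set. [claim: Mochizuki2012, status: disputed] -/
def Xi2_globalNonempty {G : Type v} (XiGlobal : G → Set G) : Prop := ∀ P, (XiGlobal P).Nonempty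

/-- [IUTchIII] Remark 3.9.5 (iv), p. 129: "if `P ∈ Hul`, then `{φ(P)} = Φ(P) = Ξ(P)`, so
`P = φ(P) = H_Φ(P) = H_Ξ(P)`" — typed (it uses that distinct nested hulls have distinct log-volumes).
[claim: Mochizuki2012, status: disputed] -/
def Remark395iv_hullCase : Prop :=
  ∀ P ∈ Hul, PhiApprox Hul φ μlog P = {φ P} ∧ XiApprox Hul φ μlog P = {φ P}

/-- [IUTchIII] Remark 3.9.5 (iv) (Ξ3) and its example, p. 129: "if `(𝕍_mod)_{v_ℚ}` … and `A` are of
cardinality `≥ 2`, then … there exist `P ∈ Preg` for which `μ^log(P) < μ^log(H_Ξ(P))`"; example: `p` prime,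
`I = ℚ_p × ℚ_p`, `H₀ = ℤ_p × ℤ_p`, `H₁ = (p^{-1}ℤ_p) × (pℤ_p)`, `P = H₀ ∪ ({p^{-1}} × ℤ_p)`, `H_P = (p^{-1}ℤ_p) × ℤ_p`,
Haar measure with `μ_I(H₀) = 1`: "`μ_I(P) = μ_I(H₀) = 1 < 2 − p^{-1} = μ_I(H₀ ∪ H₁)`". Typed as the numerical
statement about the four measures (`μ(H₀) = μ(H₁) = 1`, `μ(H₀ ∩ H₁) = p^{-1}`, `P ∖ H₀` null); the
inequality `1 < 2 − p^{-1}` is PROVED below. [claim: Mochizuki2012, status: disputed] -/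
def Xi3_example (p : ℕ) (μH0 μH1 μH01 μP : ℝ) : Prop :=
  μH0 = 1 ∧ μH1 = 1 ∧ μH01 = (p : ℝ)⁻¹ ∧ μP = 1 ∧ μP < μH0 + μH1 - μH01

/-- The inequality of the (Ξ3) example, p. 129: `1 < 2 − p^{-1}` for a prime (indeed any `p ≥ 2`) —
PROVED. [claim: Mochizuki2012, status: disputed] -/
theorem Xi3_example_ineq {p : ℕ} (hp : 2 ≤ p) : (1 : ℝ) < 1 + 1 - (p : ℝ)⁻¹ := by
  have hp' : (2 : ℝ) ≤ p := by exact_mod_cast hp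
  have : (p : ℝ)⁻¹ ≤ 2⁻¹ := by
    apply inv_anti₀ (by norm_num) hp'
  linarith

end Approximants

/-! ### (v), (vi) the set-theoretic `⊼`-formalism -/

section Upper

variable {E : Type u} (S : Set E)

/-- The relation identifying the elements of `S` ([IUTchIII] Remark 3.9.5 (v), p. 129: `E ⊼ S :=
(E ∖ S) ∐ {S}`, "the quotient of `E` obtained by identifying the elements of `S` and leaving `E ∖ S`
unaffected"). [claim: Mochizuki2012, status: disputed] -/
def upperRel (x y : E) : Prop := x = y ∨ (x ∈ S ∧ y ∈ S)

/-- `E ⊼ S` ("`E` upper `S`"), the set-theoretic quotient of `E` by `S` ([IUTchIII] Remark 3.9.5 (v),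
p. 129). [claim: Mochizuki2012, status: disputed] -/
def Upper : Type u := Quot (upperRel S)

/-- The quotient map `E ↠ E ⊼ S` (Remark 3.9.5 (v), p. 129). [claim: Mochizuki2012, status: disputed] -/
def Upper.mk (x : E) : Upper S := Quot.mk _ x

/-- [IUTchIII] Remark 3.9.5 (v), p. 129–130: "any set-theoretic map `(E ⊇) S₁ → S₂ (⊆ E)` between
nonempty subsets `S₁, S₂ ⊆ S` induces, upon passing to the quotient `E ↠ E ⊼ S`, the identity map
`⊼_S → ⊼_S` between the images [i.e., both of which are equal to `⊼_S`!] of `S₁, S₂` in `E ⊼ S`" — PROVED: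
the image of any nonempty `S₁ ⊆ S` in `E ⊼ S` is the single point `⊼_S`.
[claim: Mochizuki2012, status: disputed] -/
theorem Upper.image_eq_point {S₁ : Set E} (h₁ : S₁ ⊆ S) (hne : S₁.Nonempty) {s : E} (hs : s ∈ S) :
    Upper.mk S '' S₁ = {Upper.mk S s} := by
  apply Set.Subset.antisymm
  · rintro _ ⟨x, hx, rfl⟩
    exact Quot.sound (Or.inr ⟨h₁ hx, hs⟩)
  · rintro _ rfl
    obtain ⟨x, hx⟩ := hne
    exact ⟨x, hx, Quot.sound (Or.inr ⟨h₁ hx, hs⟩)⟩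

/-- Corollary (Remark 3.9.5 (v), p. 129–130): two nonempty subsets `S₁, S₂ ⊆ S` have the SAME image in
`E ⊼ S`, so any map `S₁ → S₂` lies over the identity of that image — PROVED.
[claim: Mochizuki2012, status: disputed] -/
theorem Upper.image_eq_image {S₁ S₂ : Set E} (h₁ : S₁ ⊆ S) (h₂ : S₂ ⊆ S) (hne₁ : S₁.Nonempty)
    (hne₂ : S₂.Nonempty) : Upper.mk S '' S₁ = Upper.mk S '' S₂ := by
  obtain ⟨s, hs⟩ := hne₁
  rw [Upper.image_eq_point S h₁ ⟨s, hs⟩ (h₁ hs), Upper.image_eq_point S h₂ hne₂ (h₁ hs)]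

/-- [IUTchIII] Remark 3.9.5 (vi), p. 130: taking `S := φ(P) ⊆ 𝓘^ℚ((−))`, the `⊼`-formalism "yields a
convenient tool for identifying `P` with its various log-volume hull-approximants `∈ Φ(P)` or
`∈ Ξ(P)` [all of which are nonempty subsets of `φ(P)`]"; "images of distinct `H₁, H₂ ∈ Hul` map to the same
subset of `𝓘^ℚ((−)) ⊼ φ(P)` if and only if `H₁, H₂ ⊆ φ(P)`". The "if" half is `Upper.image_eq_image`; the
"only if" half (which uses the shape of hull-sets) is this named statement.
[claim: Mochizuki2012, status: disputed] -/
def Remark395vi_onlyIf {X : Type u} (Hul : Set (Set X)) (φP : Set X) : Prop :=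
  ∀ H₁ ∈ Hul, ∀ H₂ ∈ Hul, H₁ ≠ H₂ → Upper.mk φP '' H₁ = Upper.mk φP '' H₂ → H₁ ⊆ φP ∧ H₂ ⊆ φP

/-- [IUTchIII] Remark 3.9.5 (vi), last paragraph, p. 130: for a bounded family `P_B = {P_β}_{β∈B}`,
`φ(P_B) := ⋂_{Hul ∋ H ⊇ P_β, ∀ β ∈ B} H`. [claim: Mochizuki2012, status: disputed] -/
def hullOfFamily {X : Type u} (Hul : Set (Set X)) {B : Type v} (P : B → Set X) : Set X :=
  ⋂₀ {H | H ∈ Hul ∧ ∀ β, P β ⊆ H}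

/-- [IUTchIII] Remark 3.9.5 (ix) (cQ3), p. 141: "hulls `∈ Hul` are stabilized by multiplication by
elements of `𝒪_k`" (hence determine objects — via `det ⊗ M` (Ob3) — of the local and global Frobenioids
in the codomain of the Θ^{×μ}_{LGP}-link), in contrast to (cQ5) log-volumes. This is `IsHullSet.mul_mem`;
(viii) ((sQ1)–(sQ5): Kummer-detachment, Galois evaluation, passage to hulls + `⊼`, vertical-shift
adjustment, passage to log-volumes "may be regarded as intricate (sub)quotient … operations") has no
further mathematical content to type. Typed here: the family of hulls of a bounded family is itself
`𝒪`-stable when every member of `Hul` is. [claim: Mochizuki2012, status: disputed] -/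
theorem Remark395ix_stable {X : Type u} [Mul X] (Hul : Set (Set X)) (Ostab : Set X)
    (hHul : ∀ H ∈ Hul, ∀ a ∈ Ostab, ∀ x ∈ H, a * x ∈ H) {B : Type v} (P : B → Set X)
    {a x : X} (ha : a ∈ Ostab) (hx : x ∈ hullOfFamily Hul P) : a * x ∈ hullOfFamily Hul P := by
  intro H hH
  exact hHul H hH.1 a ha x (hx H hH)

/-- [IUTchIII] Remark 3.9.5 (x), p. 144: "it is not possible [at least in any immediate sense!] to work
with regions `∈ Preg` that do not necessarily belong to `Hul` … by replacing the local and global Frobenioids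
… by 'more general categories of regions `∈ Preg`'", because "the Θ^{×μ}_{LGP}-link is not compatible with
the additive structures in its domain and codomain", so "one must, in effect, work with arithmetic
line bundles" (purely multiplicative). Typed as the design predicate on a class of regions: it is
admissible for the gluing iff it is contained in `Hul`. [claim: Mochizuki2012, status: disputed] -/
def Remark395x_lineBundles {X : Type u} (Hul 𝒞 : Set (Set X)) : Prop := 𝒞 ⊆ Hul

end Upper

end Literature.IUT.LogThetaLattice
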